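import Mathlib
import Summits.Ventures.PercRepro2.TypedResidualR
import Summits.Ventures.PercRepro2.TypedResidualCruxMarks
import Summits.Ventures.PercRepro2.RootBridgeVanish
import Summits.Ventures.PercRepro2.A3InactiveTypedNR

/-!
# The core of the crux: every subtraction in one statement (blind cell PercRepro2, p2 g0,
2026-08-25; sub-claim S1, `proofs/subclaims/S1-REDUCTION.md`)

All the reductions of the crux of record that the tree holds, composed:

* the S1 spine with the nine rules (`typedCount_nonneg_of_residualR`: contraction, pinned loop,
  root pair, typed loop, unmarked leaf, pendant `b` / `o`, parallel, series, free edge), the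
  rung `|F| ≤ 5` and the four-mark vanishing;
* sub-claim S2 (the separated class, `Separated.typedCount_nonneg_of_typedConfig_sep`);
* sub-claim S2.b (the same-side root bridge, `RootBridge.typedCount_nonneg_of_hasRootBridgeSameSide'`);
* the coincidence vanishings (`typedCount_eq_zero_of_not_marksDistinct`);
* conditionally, sub-claim S4's `a₃`-inactive class (`A3InactiveTyped.typedCount_nonneg_of_a3_typedDeg_zero`,
  hypothesis `TB14`).

**`ResidualCore`** — fully reduced, `|F| ≥ 6`, `a₁, a₂, o, b` of typed degree `≥ 1`, `a₁ ↔ a₂` in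
the typed graph, every typed edge in the root component, no same-side root bridge at `a₁`, the
roots distinct from every other mark and `o ≠ a₃`; **`ResidualCoreA`** — the same with `a₃` of
typed degree `≥ 1`.

* **`HCov_all_of_residualCore_all : ResidualCore_all R → HCov_all R`** — UNCONDITIONAL;
* **`HCov_all_of_residualCoreA_all (hTB : A3InactiveTyped.TB14 R) : ResidualCoreA_all R → HCov_all R`**
  — CONDITIONAL on `TB14` (an explicit hypothesis, never a fact).

Own code; standard axioms.
-/

namespace Summit.Ventures.PercRepro2

open UnionCluster

namespace CovForm

namespace TypedRed

section Core

variable {V : Type*} {E : Type*} [DecidableEq V] [Fintype E] [DecidableEq E]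

/-- **The core of the crux**: the root-connected residual instances with a connected typed graph,
no same-side root bridge at `a₁`, and the marks distinct except possibly `b = a₃` / `o = b`. -/
structure ResidualCore (ends : E → Sym2 V) (o a₁ a₂ a₃ b : V) (F : Finset E) : Prop where
  residualConR : ResidualConR ends o a₁ a₂ a₃ b F
  no_bridge : ¬ RootBridge.HasRootBridgeSameSide' ends o a₁ a₂ b F
  marks : MarksDistinct o a₁ a₂ a₃ b

/-- **The core with `a₃` active** (typed degree `≥ 1`). -/
structure ResidualCoreA (ends : E → Sym2 V) (o a₁ a₂ a₃ b : V) (F : Finset E) : Prop where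
  core : ResidualCore ends o a₁ a₂ a₃ b F
  a3_active : ∃ e ∈ F, a₃ ∈ ends e

end Core

section Closure

variable (R : Type*) [Field R] [LinearOrder R] [IsStrictOrderedRing R]

/-- **Row 2′TRI on `ResidualCore`, over every finite graph.** -/
def ResidualCore_all : Prop :=
  ∀ (V E : Type) [Fintype V] [DecidableEq V] [Fintype E] [DecidableEq E]
    (ends : E → Sym2 V) (o a₁ a₂ a₃ b : V) (F : Finset E) (τ : E → ℕ),
    (∀ e ∈ F, τ e = 1 ∨ τ e = 2) → ResidualCore ends o a₁ a₂ a₃ b F →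
      0 ≤ typedCount F (fun _ => false) τ
        (K3 ends o a₁ a₂ a₃ b : Config E → Config E → Config E → R)

/-- **Row 2′TRI on `ResidualCoreA`, over every finite graph.** -/
def ResidualCoreA_all : Prop :=
  ∀ (V E : Type) [Fintype V] [DecidableEq V] [Fintype E] [DecidableEq E]
    (ends : E → Sym2 V) (o a₁ a₂ a₃ b : V) (F : Finset E) (τ : E → ℕ),
    (∀ e ∈ F, τ e = 1 ∨ τ e = 2) → ResidualCoreA ends o a₁ a₂ a₃ b F →
      0 ≤ typedCount F (fun _ => false) τ
        (K3 ends o a₁ a₂ a₃ b : Config E → Config E → Config E → R)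

/-- **THE CRUX OF RECORD FROM (TRI) ON THE CORE** (unconditional): every other residual instance is
a theorem of the cell — separated (S2), same-side root bridge (S2.b), or a vanishing coincidence. -/
theorem HCov_all_of_residualCore_all (hc : ResidualCore_all R) : HCov_all R := by
  refine HCov_all_of_residualConR_all R ?_
  intro V E _ _ _ _ ends o a₁ a₂ a₃ b F τ hτ hres
  by_cases hbr : RootBridge.HasRootBridgeSameSide' ends o a₁ a₂ b F
  · exact RootBridge.typedCount_nonneg_of_hasRootBridgeSameSide' ends o a₁ a₂ a₃ b F τ hτ hbr
  by_cases hm : MarksDistinct o a₁ a₂ a₃ b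
  · exact hc V E ends o a₁ a₂ a₃ b F τ hτ ⟨hres, hbr, hm⟩
  · rw [typedCount_eq_zero_of_not_marksDistinct ends hm]

/-- **CONDITIONAL on `TB14`: the crux of record from (TRI) on the core with `a₃` active** — the
`a₃`-inactive core instances are p5's conditional theorem. -/
theorem HCov_all_of_residualCoreA_all (hTB : A3InactiveTyped.TB14 R) (hc : ResidualCoreA_all R) :
    HCov_all R := by
  refine HCov_all_of_residualCore_all R ?_
  intro V E _ _ _ _ ends o a₁ a₂ a₃ b F τ hτ hres
  by_cases h3 : ∃ e ∈ F, a₃ ∈ ends e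
  · exact hc V E ends o a₁ a₂ a₃ b F τ hτ ⟨hres, h3⟩
  · exact A3InactiveTyped.typedCount_nonneg_of_a3_typedDeg_zero hTB ends o a₁ a₂ a₃ b F
      (fun e he h => h3 ⟨e, he, h⟩) hres.marks.1.2.1.symm hres.marks.1.2.2.1.symm τ hτ

end Closure

end TypedRed

end CovForm

end Summit.Ventures.PercRepro2
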